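import Summits.Ventures.LatticeQCDFlow.Exactness.Phi4MetropolisPolyObsDCT
import Summits.Ventures.LatticeQCDFlow.Exactness.Phi4MetropolisCSDFloorSecondMoment
import Summits.Ventures.LatticeQCDFlow.Scoring.FreeFieldLeapfrogEquilibriumEnergy
import HarnessLib

/-!
# CRITICAL SLOWING DOWN of the local arm for the magnetisation ITSELF under ANY even step law with moments (Gaussian steps): `τ_int,sweep(M) ≥ 2χ/m₂ − ½`

HONEST FRAMING: exact (Metropolis-corrected) sampling algorithms for lattice gauge theory;
figures of merit are autocorrelation/cost numbers at stated couplings and volumes; no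
continuum-physics claim.  (SCALAR calibration rung S0-A: not a gauge result.)

Venture `LatticeQCDFlow` (cell pub-lqcd), topic `Exactness`; FANOUT row 2 (`s0-phi4`, LOCAL arm —
gen-13's leftover (α″), second half: "M itself under step laws of unbounded support").  NEW WORK of the
cell, composing `Phi4MetropolisPolyObs` / `Phi4MetropolisPolyObsDCT` (the random-site scan is a
reversible Markov `L²(e^{−S})`-contraction on `PolyObs` for every even step density with all moments)
with gen-13's pointwise second-moment carré-du-champ bound `metroScan_sq_dev_le_moment`
(`K[(g − g φ)²](φ) ≤ m₂ = ∫ u² ρ(u) du` for coordinate-1-Lipschitz `g`) and the sweep-unit locality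
floor `RevOp.thinned_tauInt_ge_of_carre_le`.  Gen-13's `Phi4MetropolisCSDFloorSecondMoment` had the
magnetisation itself only under the WINDOW; here the window is gone.  Nothing is cited as a fact.

## What is proved (`Λ = Fin (n+1)`, `V = n+1`, `λ > 0`, any real `J`)

* `integrable_sq_mul_of_moments` — all moments ⇒ `∫ u² ρ < ∞`; `polyObs_magnetisation_sub` —
  `M − c ∈ PolyObs`;
* `gaussianPDFReal_zero_neg`, `gaussianPDFReal_moments`, `integral_sq_mul_gaussianPDFReal`,
  **`metropolisScan_tauInt_sweep_ge_magnetisation_gaussian`** — the hypotheses DISCHARGED for Gaussian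
  proposals `u ∼ N(0, v)` (Mathlib's `gaussianPDFReal 0 v`): `τ_int,sweep(M) ≥ 2 Var(M)/(V v) − ½`;
* **`metropolisScan_tauInt_sweep_ge_magnetisation_of_moments`** — `ρ ≥ 0` measurable, `∫ρ = 1`,
  even, with `∫ (1+|u|)^j ρ < ∞` for every `j` (Gaussian steps `ρ = N(0, s²)`: `m₂ = s²`; the window
  `U[−δ,δ]`: `m₂ = δ²/3`); `g = M − ⟨M⟩`; summable sweep-thinned autocorrelations with `ρ_g(V) < 1` ⇒
  `τ_int,sweep(M) ≥ 2 Var(M)/(V m₂) − ½ = 2χ/m₂ − ½`.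

Reading (no numerics implied): under Gaussian proposals of standard deviation `s` the random-scan local
arm needs at least `2χ/s² − ½` sweeps per independent magnetisation — the same law as the window, with
the second moment of the step in the denominator; `z_int,M ≥ γ/ν` for every such step law.  NOT
CLAIMED: the ordered sweep; `ρ_g(V) < 1` / summability for any run; any value of `χ`; the unclipped
ACTION under the local arm (needs the energy carré bound for unbounded observables — left for a
successor: the class machinery is now in place).
-/

namespace Summit.Ventures.LatticeQCDFlow.Exactness

open Real MeasureTheory Filter Finset ProbabilityTheory
open Summit.Ventures.LatticeQCDFlow.Scoring

section MagnetisationMoments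

variable {n : ℕ}

/-- All moments give the second moment: `∫ (1+|u|)² ρ < ∞ ⇒ ∫ u² ρ < ∞`. -/
theorem integrable_sq_mul_of_moments {ρ : ℝ → ℝ} (hρ0 : ∀ u, 0 ≤ ρ u) (hρm : Measurable ρ)
    (hρmom : ∀ j : ℕ, Integrable (fun u => (1 + |u|) ^ j * ρ u)) :
    Integrable (fun u => u ^ 2 * ρ u) := by
  refine Integrable.mono' (hρmom 2) ((measurable_id.pow_const 2).mul hρm).aestronglyMeasurable
    (Eventually.of_forall fun u => ?_)
  rw [Real.norm_eq_abs, abs_mul, abs_of_nonneg (sq_nonneg u), abs_of_nonneg (hρ0 u)]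
  refine mul_le_mul_of_nonneg_right ?_ (hρ0 u)
  rw [← sq_abs u]
  nlinarith [abs_nonneg u]

/-- `M − c` is a polynomial-envelope observable. -/
theorem polyObs_magnetisation_sub (c : ℝ) :
    PolyObs (fun φ : Fin (n + 1) → ℝ => (∑ y, φ y) - c) := by
  obtain ⟨hm, B, k, hb⟩ := polyObs_magnetisation (n := n)
  refine ⟨hm.sub measurable_const, |B| + |c|, k, fun φ => ?_⟩
  have e1 : 1 ≤ (1 + ∑ w, φ w ^ 2) ^ k := one_le_pow₀ (one_le_env φ)
  calc |(∑ y, φ y) - c| ≤ |∑ y, φ y| + |c| := abs_sub _ _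
    _ ≤ |B| * (1 + ∑ w, φ w ^ 2) ^ k + |c| * (1 + ∑ w, φ w ^ 2) ^ k :=
        add_le_add (abs_le_abs_mul_env hb φ) (le_mul_of_one_le_right (abs_nonneg c) e1)
    _ = (|B| + |c|) * (1 + ∑ w, φ w ^ 2) ^ k := by ring

/-- **CRITICAL SLOWING DOWN OF THE LOCAL ARM FOR THE MAGNETISATION ITSELF, ANY EVEN STEP LAW WITH
MOMENTS.**  Lattice φ⁴, every `λ > 0`, every real `J`; `ρ ≥ 0` measurable with `∫ρ = 1`, even, and
`∫ (1+|u|)^j ρ < ∞` for every `j` (Gaussian steps included); `K` the random-site-scan Metropolis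
operator, `g = M − ⟨M⟩`, one sweep = `n+1` site updates.  If the sweep-thinned autocorrelation series of
`g` is summable and `ρ_g(n+1) < 1`, then
`τ_int,sweep(M) ≥ 2 ⟨(M − ⟨M⟩)²⟩ / ((n+1) m₂) − ½`,  `m₂ = ∫ u² ρ(u) du`. -/
theorem metropolisScan_tauInt_sweep_ge_magnetisation_of_moments {lam : ℝ} (hlam : 0 < lam)
    (J : Fin (n + 1) → Fin (n + 1) → ℝ) {ρ : ℝ → ℝ} (hρ0 : ∀ u, 0 ≤ ρ u) (hρm : Measurable ρ)
    (hρi : Integrable ρ) (hρ1 : ∫ u, ρ u = 1) (hρs : ∀ u, ρ (-u) = ρ u)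
    (hρmom : ∀ j : ℕ, Integrable (fun u => (1 + |u|) ^ j * ρ u))
    (hs : Summable fun k => (∫ φ, ((∑ y, φ y) - gibbsExpect J lam (fun ψ => ∑ y, ψ y))
        * ((metroScan J lam ρ)^[(n + 1) * (k + 1)]
            (fun ψ => (∑ y, ψ y) - gibbsExpect J lam (fun ψ => ∑ y, ψ y))) φ * gibbsWeight J lam φ)
        / ∫ φ, ((∑ y, φ y) - gibbsExpect J lam (fun ψ => ∑ y, ψ y)) ^ 2 * gibbsWeight J lam φ)
    (hρV : (∫ φ, ((∑ y, φ y) - gibbsExpect J lam (fun ψ => ∑ y, ψ y))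
        * ((metroScan J lam ρ)^[n + 1]
            (fun ψ => (∑ y, ψ y) - gibbsExpect J lam (fun ψ => ∑ y, ψ y))) φ * gibbsWeight J lam φ)
        / (∫ φ, ((∑ y, φ y) - gibbsExpect J lam (fun ψ => ∑ y, ψ y)) ^ 2 * gibbsWeight J lam φ)
        < 1) :
    2 * gibbsExpect J lam (fun φ => ((∑ y, φ y) - gibbsExpect J lam (fun ψ => ∑ y, ψ y)) ^ 2)
        / ((n + 1) * ∫ u, u ^ 2 * ρ u) - 1 / 2
      ≤ tauInt (fun k => (∫ φ, ((∑ y, φ y) - gibbsExpect J lam (fun ψ => ∑ y, ψ y))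
        * ((metroScan J lam ρ)^[(n + 1) * k]
            (fun ψ => (∑ y, ψ y) - gibbsExpect J lam (fun ψ => ∑ y, ψ y))) φ * gibbsWeight J lam φ)
        / ∫ φ, ((∑ y, φ y) - gibbsExpect J lam (fun ψ => ∑ y, ψ y)) ^ 2 * gibbsWeight J lam φ) := by
  have hco := latticePhi4Action_coercive hlam J
  have hρ2 := integrable_sq_mul_of_moments hρ0 hρm hρmom
  set c := gibbsExpect J lam (fun ψ : Fin (n + 1) → ℝ => ∑ y, ψ y) with hc
  have hg : PolyObs (fun ψ : Fin (n + 1) → ℝ => (∑ y, ψ y) - c) := polyObs_magnetisation_sub c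
  have hg2 : PolyObs (fun ψ : Fin (n + 1) → ℝ => ((∑ y, ψ y) - c) ^ 2) := polyObs_sq hg
  have hglip : ∀ (φ : Fin (n + 1) → ℝ) (x : Fin (n + 1)) (t' : ℝ),
      |((∑ y, Function.update φ x t' y) - c) - ((∑ y, φ y) - c)| ≤ |t' - φ x| := by
    intro φ x t'
    rw [show ((∑ y, Function.update φ x t' y) - c) - ((∑ y, φ y) - c) = t' - φ x by
      rw [← sum_update_sub_sum φ x t']; ring]
  have hΓ : ∀ φ, metroScan J lam ρ (fun ψ => (((∑ y, ψ y) - c) - ((∑ y, φ y) - c)) ^ 2) φ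
      ≤ ∫ u, u ^ 2 * ρ u := fun φ => metroScan_sq_dev_le_moment J lam hρ0 hρ2 φ (hglip φ)
  have hfloor := RevOp.thinned_tauInt_ge_of_carre_le (μ := volume) (A := PolyObs)
    (K := metroScan J lam ρ) (w := gibbsWeight J lam)
    (fun φ => (gibbsWeight_pos J lam φ).le) (polyObs_const 1)
    (fun f h hf hh => polyObs_integrable_mul_mul_gibbsWeight one_pos hco hf hh)
    (fun f h c hf hh => polyObs_add_mul hf hh c)
    (fun f hf => polyObs_metroScan J lam hρ0 hρm hρmom hf)
    (fun f h c hf hh x => metroScan_add_mul_poly J lam hρ0 hρm hρmom hf hh c x)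
    (fun f h hf hh => metroScan_reversible_poly one_pos hco hρ0 hρm hρi hρ1 hρs hρmom hf hh)
    (fun f hf => metroScan_contraction_poly one_pos hco hρ0 hρm hρi hρ1 hρs hρmom hf)
    (fun φ => metroScan_one J lam hρ1 φ) hg hg2 hΓ (show 0 < n + 1 by omega) hs hρV
  have e : ∀ P Z D : ℝ, 2 * (P / Z) / (((n : ℝ) + 1) * D) - 1 / 2
      = 2 * P / (((n + 1 : ℕ) : ℝ) * D * Z) - 1 / 2 := by
    intro P Z D
    push_cast
    rw [← mul_div_assoc, div_div, mul_comm Z]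
  exact (e _ _ _).le.trans hfloor

/-! ## Gaussian proposals: the hypotheses discharged -/

/-- The centred Gaussian density is even. -/
theorem gaussianPDFReal_zero_neg (v : NNReal) (u : ℝ) :
    gaussianPDFReal 0 v (-u) = gaussianPDFReal 0 v u := by
  simp only [gaussianPDFReal_def, sub_zero, neg_pow_two]

/-- **A Gaussian step law has all moments**: `∫ (1+|u|)^j N(0,v)(u) du < ∞` for every `j` (`v ≠ 0`). -/
theorem gaussianPDFReal_moments {v : NNReal} (hv : v ≠ 0) (j : ℕ) :
    Integrable (fun u : ℝ => (1 + |u|) ^ j * gaussianPDFReal 0 v u) := by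
  have hvpos : (0 : ℝ) < v := by
    have := v.2
    rcases this.eq_or_lt with h | h
    · exact absurd (NNReal.coe_eq_zero.mp h.symm) hv
    · exact h
  set b : ℝ := 1 / (2 * (v : ℝ)) with hb
  have hb0 : 0 < b := by rw [hb]; positivity
  set c : ℝ := (Real.sqrt (2 * Real.pi * v))⁻¹ with hc
  have hc0 : 0 ≤ c := by rw [hc]; positivity
  have hρ : ∀ u : ℝ, gaussianPDFReal 0 v u = c * Real.exp (-b * u ^ 2) := by
    intro u
    rw [gaussianPDFReal_def, hc, hb]
    field_simp
    ring
  have h0 := integrable_pow_mul_gaussian hb0 0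
  have h2j := integrable_pow_mul_gaussian hb0 (2 * j)
  have hR : Integrable (fun u : ℝ => (2 : ℝ) ^ j * c * (u ^ 0 * Real.exp (-b * u ^ 2)
      + u ^ (2 * j) * Real.exp (-b * u ^ 2))) := (h0.add h2j).const_mul _
  refine Integrable.mono' hR ((((measurable_const.add measurable_id.abs).pow_const j)).mul
    (measurable_gaussianPDFReal 0 v)).aestronglyMeasurable (Eventually.of_forall fun u => ?_)
  rw [Real.norm_eq_abs, abs_mul, abs_of_nonneg (by positivity), abs_of_nonneg (gaussianPDFReal_nonneg _ _ _),
    hρ u, pow_zero, one_mul]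
  have hexp : 0 ≤ Real.exp (-b * u ^ 2) := (Real.exp_pos _).le
  -- `(1+|u|)^j ≤ 2^j (1 + u^{2j})`
  have hkey : (1 + |u|) ^ j ≤ (2 : ℝ) ^ j * (1 + u ^ (2 * j)) := by
    rcases le_or_gt |u| 1 with hu | hu
    · calc (1 + |u|) ^ j ≤ (2 : ℝ) ^ j := pow_le_pow_left₀ (by positivity) (by linarith) j
        _ ≤ (2 : ℝ) ^ j * (1 + u ^ (2 * j)) := by
            have : 0 ≤ u ^ (2 * j) := by rw [pow_mul]; positivity
            nlinarith [pow_pos (show (0:ℝ) < 2 by norm_num) j]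
    · have h1 : (1 + |u|) ^ j ≤ (2 * |u|) ^ j := pow_le_pow_left₀ (by positivity) (by linarith) j
      have h2 : |u| ^ j ≤ |u| ^ (2 * j) := pow_le_pow_right₀ hu.le (by omega)
      have h3 : |u| ^ (2 * j) = u ^ (2 * j) := by rw [pow_mul, sq_abs, ← pow_mul]
      calc (1 + |u|) ^ j ≤ (2 : ℝ) ^ j * |u| ^ j := by rw [mul_pow] at h1; exact h1
        _ ≤ (2 : ℝ) ^ j * u ^ (2 * j) := by
            rw [← h3]; exact mul_le_mul_of_nonneg_left h2 (by positivity)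
        _ ≤ (2 : ℝ) ^ j * (1 + u ^ (2 * j)) := by
            have : 0 ≤ u ^ (2 * j) := by rw [pow_mul]; positivity
            nlinarith [pow_pos (show (0:ℝ) < 2 by norm_num) j]
  calc (1 + |u|) ^ j * (c * Real.exp (-b * u ^ 2))
      ≤ (2 : ℝ) ^ j * (1 + u ^ (2 * j)) * (c * Real.exp (-b * u ^ 2)) :=
        mul_le_mul_of_nonneg_right hkey (mul_nonneg hc0 hexp)
    _ = (2 : ℝ) ^ j * c * (Real.exp (-b * u ^ 2) + u ^ (2 * j) * Real.exp (-b * u ^ 2)) := by ring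

/-- **The second moment of the Gaussian step law is `v`**: `∫ u² N(0,v)(u) du = v`. -/
theorem integral_sq_mul_gaussianPDFReal {v : NNReal} (hv : v ≠ 0) :
    ∫ u : ℝ, u ^ 2 * gaussianPDFReal 0 v u = v := by
  have h := integral_sq_gaussianReal v
  rw [integral_gaussianReal_eq_integral_smul hv] at h
  rw [← h]
  refine integral_congr_ae (Eventually.of_forall fun u => ?_)
  simp only [smul_eq_mul]
  ring

/-- **GAUSSIAN PROPOSALS**: for the random-site-scan Metropolis arm with steps `u ∼ N(0, v)`
(`v ≠ 0` the proposal variance), every `λ > 0`, every real `J`, `g = M − ⟨M⟩`: summable sweep-thinned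
autocorrelations with `ρ_g(n+1) < 1` ⇒ `τ_int,sweep(M) ≥ 2 Var(M)/((n+1) v) − ½ = 2χ/v − ½`. -/
theorem metropolisScan_tauInt_sweep_ge_magnetisation_gaussian {lam : ℝ} (hlam : 0 < lam)
    (J : Fin (n + 1) → Fin (n + 1) → ℝ) {v : NNReal} (hv : v ≠ 0)
    (hs : Summable fun k => (∫ φ, ((∑ y, φ y) - gibbsExpect J lam (fun ψ => ∑ y, ψ y))
        * ((metroScan J lam (gaussianPDFReal 0 v))^[(n + 1) * (k + 1)]
            (fun ψ => (∑ y, ψ y) - gibbsExpect J lam (fun ψ => ∑ y, ψ y))) φ * gibbsWeight J lam φ)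
        / ∫ φ, ((∑ y, φ y) - gibbsExpect J lam (fun ψ => ∑ y, ψ y)) ^ 2 * gibbsWeight J lam φ)
    (hρV : (∫ φ, ((∑ y, φ y) - gibbsExpect J lam (fun ψ => ∑ y, ψ y))
        * ((metroScan J lam (gaussianPDFReal 0 v))^[n + 1]
            (fun ψ => (∑ y, ψ y) - gibbsExpect J lam (fun ψ => ∑ y, ψ y))) φ * gibbsWeight J lam φ)
        / (∫ φ, ((∑ y, φ y) - gibbsExpect J lam (fun ψ => ∑ y, ψ y)) ^ 2 * gibbsWeight J lam φ)
        < 1) :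
    2 * gibbsExpect J lam (fun φ => ((∑ y, φ y) - gibbsExpect J lam (fun ψ => ∑ y, ψ y)) ^ 2)
        / ((n + 1) * (v : ℝ)) - 1 / 2
      ≤ tauInt (fun k => (∫ φ, ((∑ y, φ y) - gibbsExpect J lam (fun ψ => ∑ y, ψ y))
        * ((metroScan J lam (gaussianPDFReal 0 v))^[(n + 1) * k]
            (fun ψ => (∑ y, ψ y) - gibbsExpect J lam (fun ψ => ∑ y, ψ y))) φ * gibbsWeight J lam φ)
        / ∫ φ, ((∑ y, φ y) - gibbsExpect J lam (fun ψ => ∑ y, ψ y)) ^ 2 * gibbsWeight J lam φ) := by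
  have h := metropolisScan_tauInt_sweep_ge_magnetisation_of_moments hlam J
    (fun u => gaussianPDFReal_nonneg 0 v u) (measurable_gaussianPDFReal 0 v)
    (integrable_gaussianPDFReal 0 v) (integral_gaussianPDFReal_eq_one 0 hv)
    (gaussianPDFReal_zero_neg v) (gaussianPDFReal_moments hv) hs hρV
  rw [integral_sq_mul_gaussianPDFReal hv] at h
  exact h

end MagnetisationMoments

end Summit.Ventures.LatticeQCDFlow.Exactness
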